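import Summits.CriticalPhenomena.Ising3DConformalLimit.Theorems.EnergyNotSigmaSquaredMoebiusLimitExistsDefs
import Literature.Probability.LatticeModels.Sweep1
import HarnessLib

/-!
# Objects of the MIRROR-PEDIGREE recursion of line `only-interaction-breaks-moebius`
(crux `MoebiusLimitExists`, item stmt-CriticalPhenomena-1344; companion of
`EnergyNotSigmaSquaredMoebiusLimitExistsDefs.lean`)

Route-posited objects (D-0016) for the proof of the line's residue `stub_equicontinuity_inner`
(single-variable asymptotic equicontinuity of the pinned critical zoom where no coordinate slab
separates the moving point) by REFLECTION-POSITIVITY MIRROR PEDIGREES (standing disprover, gen 4,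
`Cruxes/MoebiusLimitExists/Disproof.lean` §G; refuter toolkit `Theorems/MoebiusLimitExists/Negative/PedigreeCuts.lean`):
the cluster RP–Cauchy–Schwarz move inequality in one of the nine cubic site mirrors of `ℤ³` reduces
regularity of the `(a+b)`-point zoom at `(x, i)` (cluster `A ∋ i` below the mirror, `B` above) to
regularity of the `(a+a)`-point zoom at the DOUBLED configuration `A ∪ θA` (the block `B` is
discarded), and every finite configuration admits a finite sequence of such cuts after which the
moving point is the strict extreme point in a coordinate direction (the covering theorem).

Contents (definitions and their unfolding lemmas only; no mathematics):
* `zdot`, `IsCubicDir` — integer directions `g ∈ {±eτ, ±eτ ± eτ'}` of the nine mirror families;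
* `latticeMirror g c` — the site mirror of `ℤ³` in the plane `{zdot g · = c}`;
* `rdotZ g`, `reflectZ g T` — the same functional / mirror on `ℝ³` (threshold `T : ℝ`);
* `doubledA g T x`, `doubledB g T x` — the doubled configurations `A ∪ θA`, `θB ∪ B` of
  `x = (x_A, x_B) : Fin (a + b) → ℝ³`;
* `SVEquicont u n K i` — single-variable asymptotic equicontinuity of the pinned `n`-point zoom at
  index `i` on `K` along the mesh sequence `u`;
* `PedigreeOK μ d x i` — `x` admits a mirror pedigree of depth `≤ d` with margin `μ` for the moving
  index `i` (depth `0` = the separation hypothesis of the landed base case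
  `sepMove_equicontinuity`; a step = an admissible cubic cut, encoded by an enumeration
  `e : Fin (a + b) ≃ Fin n` putting the kept cluster first, followed by a pedigree of the doubled
  configuration).

References: FILS 1978 §2 (site-mirror reflection positivity); the pedigree recursion and covering
theorem are the standing disprover's (Disproof.lean §G.1–G.4, kernel-checked there).
-/

noncomputable section

open Filter Topology Set Function
open Literature.Probability.LatticeModels

namespace Summit.CriticalPhenomena.Ising3DConformalLimit.MoebiusLimitExistsOnlyInteraction

/-! ### Integer directions and lattice mirrors -/

/-- Explicit dot product on `ℤ³`. [folklore] -/
def zdot (g v : Site 3) : ℤ := g 0 * v 0 + g 1 * v 1 + g 2 * v 2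

/-- `g` is one of the 18 signed CUBIC directions `±eτ`, `±eτ ± eτ'` (`τ ≠ τ'`): entries in
`{−1, 0, 1}` and `zdot g g ∈ {1, 2}` — exactly the normals of the site mirrors of `ℤ³` in which the
nearest-neighbour Ising model is reflection positive. [cite: FILS1978, §2] -/
def IsCubicDir (g : Site 3) : Prop :=
  (∀ j, g j = -1 ∨ g j = 0 ∨ g j = 1) ∧ (zdot g g = 1 ∨ zdot g g = 2)

/-- The site mirror of `ℤ³` in the plane `{zdot g · = c}` for a cubic direction `g`:
`v ↦ v − (2 (g·v − c)/‖g‖²) g`, kept integral (`2 / zdot g g` is `2` for coordinate and `1` for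
diagonal directions). [cite: FILS1978, §2] -/
def latticeMirror (g : Site 3) (c : ℤ) (v : Site 3) : Site 3 :=
  v - ((2 / zdot g g) * (zdot g v - c)) • g

/-! ### The same functional and mirror on `ℝ³` -/

/-- The linear functional `v ↦ g·v` on `ℝ³` for an integer direction `g`. [folklore] -/
def rdotZ (g : Site 3) (v : EuclideanSpace ℝ (Fin 3)) : ℝ :=
  (g 0 : ℝ) * v 0 + (g 1 : ℝ) * v 1 + (g 2 : ℝ) * v 2

/-- The Euclidean reflection of `ℝ³` in the affine mirror `{rdotZ g · = T}`. [folklore] -/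
def reflectZ (g : Site 3) (T : ℝ) (v : EuclideanSpace ℝ (Fin 3)) : EuclideanSpace ℝ (Fin 3) :=
  v - (2 * (rdotZ g v - T) / (zdot g g : ℝ)) • siteVec g

/-! ### Doubled configurations -/

/-- The doubled `A`-configuration `A ∪ θA` (order `a + a`) of `x = (x_A, x_B) : Fin (a + b) → ℝ³`.
[folklore] -/
def doubledA (g : Site 3) (T : ℝ) {a b : ℕ} (x : Fin (a + b) → EuclideanSpace ℝ (Fin 3)) :
    Fin (a + a) → EuclideanSpace ℝ (Fin 3) :=
  Fin.append (fun j => x (Fin.castAdd b j)) (fun j => reflectZ g T (x (Fin.castAdd b j)))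

/-- The doubled `B`-configuration `θB ∪ B` (order `b + b`) of `x = (x_A, x_B) : Fin (a + b) → ℝ³`.
[folklore] -/
def doubledB (g : Site 3) (T : ℝ) {a b : ℕ} (x : Fin (a + b) → EuclideanSpace ℝ (Fin 3)) :
    Fin (b + b) → EuclideanSpace ℝ (Fin 3) :=
  Fin.append (fun j => reflectZ g T (x (Fin.natAdd a j))) (fun j => x (Fin.natAdd a j))

/-! ### Single-variable asymptotic equicontinuity and pedigrees -/

/-- SINGLE-VARIABLE ASYMPTOTIC EQUICONTINUITY of the pinned `n`-point zoom at the index `i` on the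
set `K` along the mesh sequence `u`: for every `ε > 0` there is `η > 0` such that eventually in `k`,
`|F_k x − F_k x'| < ε` whenever `x, x' ∈ K` differ only at the index `i` and `dist x x' < η`
(`F_k = ρ_pin(u k)ⁿ ⟨∏ⱼ σ_{[xⱼ/u k]}⟩_{β_c}`). [folklore] -/
def SVEquicont (u : ℕ → ℝ) (n : ℕ) (K : Set (Fin n → EuclideanSpace ℝ (Fin 3))) (i : Fin n) : Prop :=
  ∀ ε > 0, ∃ η > 0, ∀ᶠ k in atTop, ∀ x ∈ K, ∀ x' ∈ K, (∀ j, j ≠ i → x' j = x j) → dist x x' < η →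
    |rescaledCorrelator (criticalCorr 3) rhoPin n (u k) x -
      rescaledCorrelator (criticalCorr 3) rhoPin n (u k) x'| < ε

/-- MIRROR PEDIGREE of depth `≤ d` with margin `μ` for the moving index `i` of the configuration
`x : Fin n → ℝ³`. Depth `0` (terminal): `x i` is separated from all other points by a slab of width
`μ` in some coordinate (the hypothesis of the base case `sepMove_equicontinuity`). Depth `d + 1`:
depth `≤ d`, or an admissible CUT — a cubic direction `g`, a threshold `T`, an enumeration
`e : Fin (a + b) ≃ Fin n` of the indices with the kept cluster (`rdotZ g · + μ ≤ T`, containing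
`i = e (castAdd b i₀)`) first and the discarded block (`T + μ ≤ rdotZ g ·`) last — followed by a
pedigree of depth `≤ d`, margin `μ`, for the doubled configuration `A ∪ θA` with the same moving
index. [folklore] -/
def PedigreeOK (μ : ℝ) : ℕ → (n : ℕ) → (Fin n → EuclideanSpace ℝ (Fin 3)) → Fin n → Prop
  | 0, _, x, i => ∃ τ : Fin 3, (∀ j, j ≠ i → x i τ + μ ≤ x j τ) ∨ (∀ j, j ≠ i → x j τ + μ ≤ x i τ)
  | d + 1, n, x, i => PedigreeOK μ d n x i ∨
      ∃ (g : Site 3) (T : ℝ) (a b : ℕ) (e : Fin (a + b) ≃ Fin n) (i₀ : Fin a),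
        IsCubicDir g ∧ e (Fin.castAdd b i₀) = i ∧
        (∀ j : Fin a, rdotZ g (x (e (Fin.castAdd b j))) + μ ≤ T) ∧
        (∀ j : Fin b, T + μ ≤ rdotZ g (x (e (Fin.natAdd a j)))) ∧
        PedigreeOK μ d (a + a) (doubledA g T (x ∘ ⇑e)) (Fin.castAdd a i₀)

/-! ### Unfolding lemmas -/

/-- Coordinates of the lattice mirror. [folklore] -/
theorem latticeMirror_apply (g : Site 3) (c : ℤ) (v : Site 3) (j : Fin 3) :
    latticeMirror g c v j = v j - (2 / zdot g g) * (zdot g v - c) * g j := by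
  simp [latticeMirror, mul_assoc]

/-- Coordinates of the Euclidean mirror. [folklore] -/
theorem reflectZ_apply (g : Site 3) (T : ℝ) (v : EuclideanSpace ℝ (Fin 3)) (j : Fin 3) :
    reflectZ g T v j = v j - 2 * (rdotZ g v - T) / (zdot g g : ℝ) * (g j : ℝ) := by
  simp [reflectZ]

/-- The kept block of `doubledA`. [folklore] -/
@[simp] theorem doubledA_left (g : Site 3) (T : ℝ) {a b : ℕ} (x : Fin (a + b) → EuclideanSpace ℝ (Fin 3))
    (j : Fin a) : doubledA g T x (Fin.castAdd a j) = x (Fin.castAdd b j) := by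
  rw [doubledA, Fin.append_left]

/-- The mirrored block of `doubledA`. [folklore] -/
@[simp] theorem doubledA_right (g : Site 3) (T : ℝ) {a b : ℕ} (x : Fin (a + b) → EuclideanSpace ℝ (Fin 3))
    (j : Fin a) : doubledA g T x (Fin.natAdd a j) = reflectZ g T (x (Fin.castAdd b j)) := by
  rw [doubledA, Fin.append_right]

/-- The mirrored block of `doubledB`. [folklore] -/
@[simp] theorem doubledB_left (g : Site 3) (T : ℝ) {a b : ℕ} (x : Fin (a + b) → EuclideanSpace ℝ (Fin 3))
    (j : Fin b) : doubledB g T x (Fin.castAdd b j) = reflectZ g T (x (Fin.natAdd a j)) := by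
  rw [doubledB, Fin.append_left]

/-- The kept block of `doubledB`. [folklore] -/
@[simp] theorem doubledB_right (g : Site 3) (T : ℝ) {a b : ℕ} (x : Fin (a + b) → EuclideanSpace ℝ (Fin 3))
    (j : Fin b) : doubledB g T x (Fin.natAdd b j) = x (Fin.natAdd a j) := by
  rw [doubledB, Fin.append_right]

/-- Depth `0` of a pedigree is the coordinate-slab separation of the moving point. [folklore] -/
theorem pedigreeOK_zero (μ : ℝ) {n : ℕ} (x : Fin n → EuclideanSpace ℝ (Fin 3)) (i : Fin n) :
    PedigreeOK μ 0 n x i ↔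
      ∃ τ : Fin 3, (∀ j, j ≠ i → x i τ + μ ≤ x j τ) ∨ (∀ j, j ≠ i → x j τ + μ ≤ x i τ) := Iff.rfl

/-- Unfolding of depth `d + 1` of a pedigree. [folklore] -/
theorem pedigreeOK_succ (μ : ℝ) (d : ℕ) {n : ℕ} (x : Fin n → EuclideanSpace ℝ (Fin 3)) (i : Fin n) :
    PedigreeOK μ (d + 1) n x i ↔ PedigreeOK μ d n x i ∨
      ∃ (g : Site 3) (T : ℝ) (a b : ℕ) (e : Fin (a + b) ≃ Fin n) (i₀ : Fin a),
        IsCubicDir g ∧ e (Fin.castAdd b i₀) = i ∧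
        (∀ j : Fin a, rdotZ g (x (e (Fin.castAdd b j))) + μ ≤ T) ∧
        (∀ j : Fin b, T + μ ≤ rdotZ g (x (e (Fin.natAdd a j)))) ∧
        PedigreeOK μ d (a + a) (doubledA g T (x ∘ ⇑e)) (Fin.castAdd a i₀) := Iff.rfl

/-- A pedigree of depth `≤ d` is a pedigree of depth `≤ d + 1`. [folklore] -/
theorem PedigreeOK.succ {μ : ℝ} {d n : ℕ} {x : Fin n → EuclideanSpace ℝ (Fin 3)} {i : Fin n}
    (h : PedigreeOK μ d n x i) : PedigreeOK μ (d + 1) n x i := Or.inl h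

/-- A pedigree of depth `≤ d` is a pedigree of every depth `≤ d'`, `d ≤ d'`. [folklore] -/
theorem PedigreeOK.of_le {μ : ℝ} {d d' n : ℕ} {x : Fin n → EuclideanSpace ℝ (Fin 3)} {i : Fin n}
    (h : PedigreeOK μ d n x i) (hle : d ≤ d') : PedigreeOK μ d' n x i := by
  induction hle with
  | refl => exact h
  | step _ ih => exact ih.succ

/-- Depth monotonicity of pedigrees, closed form (the registered anchor of this Defs file).
[folklore] -/
theorem pedigreeOK_mono_depth :
    ∀ (μ : ℝ) (d d' n : ℕ) (x : Fin n → EuclideanSpace ℝ (Fin 3)) (i : Fin n),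
      d ≤ d' → PedigreeOK μ d n x i → PedigreeOK μ d' n x i :=
  fun _ _ _ _ _ _ hle h => h.of_le hle

end Summit.CriticalPhenomena.Ising3DConformalLimit.MoebiusLimitExistsOnlyInteraction

end
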